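import Mathlib
import Literature.Analysis.FluidPDE.SelfSimilarEulerProfile
import Summits.NavierStokesRegularity.NavierStokesRegularity.Theorems.EulerZoomLiouvillePowerGaugeEulerLiouvilleSelfSimilarKelvinFlow
import Summits.NavierStokesRegularity.NavierStokesRegularity.Theorems.EulerZoomLiouvillePowerGaugeEulerLiouvilleSelfSimilarBackwardEscape
import HarnessLib

/-!
# «ONLY NEAR-CIRCULAR ORBITS SURVIVE», tools: the radial rate along backward arcs, derivative-sign lemmas, and the BAND BOOTSTRAP
# (crux `EulerZoomLiouville.PowerGaugeEulerLiouville` = stmt-NavierStokesRegularity-19832, THE ONE STATEMENT `stub_selfSimilarC2Needle`)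

Route `EulerZoomLiouville` (NavierStokesRegularity), crux E, LEAD seat ns-typeII-p2 g13 (own brick, sequel of «any fast channel kills»).  Class-free ODE
tools.  For a `C¹` field `V` on `ℝ³` let `W y = γy + V y` (`selfSimilarTransport γ 0 V`), `ℛ(y) = ⟪y, W y⟫` the RADIAL RATE and
`a(y) = ‖W y‖² + γ⟪y, W y⟫ + ⟪y, DV(y)(W y)⟫ = Dℛ(y)[W y]` the (forward) RADIAL ACCELERATION of the similarity flow.  Along a BACKWARD arc `Z′ = −W(Z)`:
`(ℛ∘Z)′ = −a(Z)` and `(‖Z‖²)′ = −2ℛ(Z)`.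

* `BandClock.hasDerivAt_radialRate_comp` — `(ℛ∘Z)′ σ = −a(Z σ)`.
* `BandClock.eventually_lt_right_of_hasDerivAt_neg` — a real function with negative derivative at `x` is `< f x` just to the right of `x` (slope form of
  the derivative; the left twin is the tree's `Literature.NumberTheory.LFunctions.Nicolas.eventually_nhdsLT_lt_of_hasDerivAt_neg`).
* `BandClock.band_bootstrap` — THE BAND BOOTSTRAP: along a backward arc on `[t₀, t₁]` that is Bernoulli-high (`ℋ > h`) and vortical throughout, starts beyond
  `2R₁` with `ℛ(Z t₀) + m₀‖Z t₀‖² ≤ 0` (`m₀ ≥ 0`), if the INFLOW HALF-BAND DEFICIT holds beyond `R₁` — `a(y) ≥ (2c₁² + μ)‖y‖²` at every vortical point of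
  `{ℋ > h}` with `‖y‖ ≥ R₁` and `−c₁‖y‖² ≤ ℛ(y) ≤ 0` — then for every slope `0 ≤ κ < μ` with `m₀ + κ(t₁ − t₀) ≤ c₁` the arc obeys, for all
  `s ∈ [t₀, t₁]`: `‖Z t₀‖ ≤ ‖Z s‖` and `ℛ(Z s) + (m₀ + κ(s − t₀))‖Z s‖² ≤ 0` (the radial rate sinks linearly below `−m₀` and the radius never decreases).
  Mechanism: at the supremum `s*` of the good set both conditions hold (closedness); the radius condition persists because the radius is non-decreasing
  wherever `ℛ ≤ 0`; the rate condition persists because where it is tight the point lies in the inflow half-band, so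
  `(ℛ + m‖Z‖²)′ = −a + κ‖Z‖² + 2m²‖Z‖² ≤ (κ − μ)‖Z‖² < 0`.

WHAT THIS IS NOT: not NS, not E — class-free calculus/ODE lemmas (no budgets, no profile equation), `--supports` stmt-19832; the crux is OPEN; NS regularity
is NOT proved. [folklore; cf. ConstantinIgnatovaVicol2026Putative §3.4 (3.19)–(3.20)]
-/

noncomputable section

-- flat `Theorems/<Route><Decl>…` files of one crux share the namespace of the crux (tree convention: `Summit.<S>.<S>.…`)
set_option linter.dupNamespace false

open Set Filter Topology Metric
open scoped RealInnerProductSpace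

namespace Summit.NavierStokesRegularity.NavierStokesRegularity.Theorems.PowerGaugeEulerLiouville

open Literature.Analysis Literature.Analysis.FluidPDE

namespace BandClock

variable {γ : ℝ} {V : EuclideanSpace ℝ (Fin 3) → EuclideanSpace ℝ (Fin 3)}

/-- **The radial rate along a backward arc**: for `V ∈ C¹` and `Z′ σ = −W(Z σ)`,
`d/dσ ⟪Z σ, W(Z σ)⟫ = −(‖W‖² + γ⟪Z, W⟫ + ⟪Z, DV(Z)(W)⟫)(Z σ)`. [folklore] -/
theorem hasDerivAt_radialRate_comp (hV : ContDiff ℝ 1 V) {Z : ℝ → EuclideanSpace ℝ (Fin 3)} {σ : ℝ}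
    (hZ : HasDerivAt Z (-(selfSimilarTransport γ 0 V (Z σ))) σ) :
    HasDerivAt (fun s => ⟪Z s, selfSimilarTransport γ 0 V (Z s)⟫)
      (-(‖selfSimilarTransport γ 0 V (Z σ)‖ ^ 2 + γ * ⟪Z σ, selfSimilarTransport γ 0 V (Z σ)⟫ +
        ⟪Z σ, fderiv ℝ V (Z σ) (selfSimilarTransport γ 0 V (Z σ))⟫)) σ := by
  have hVd : HasFDerivAt V (fderiv ℝ V (Z σ)) (Z σ) := ((hV.differentiable one_ne_zero) (Z σ)).hasFDerivAt
  have hW : HasFDerivAt (selfSimilarTransport γ 0 V)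
      (γ • ContinuousLinearMap.id ℝ (EuclideanSpace ℝ (Fin 3)) + fderiv ℝ V (Z σ)) (Z σ) := by
    have h : HasFDerivAt (fun z : EuclideanSpace ℝ (Fin 3) => γ • (z - 0) + V z)
        (γ • ContinuousLinearMap.id ℝ (EuclideanSpace ℝ (Fin 3)) + fderiv ℝ V (Z σ)) (Z σ) :=
      (((hasFDerivAt_id (Z σ)).sub_const 0).fun_const_smul γ).fun_add hVd
    have e : (fun z : EuclideanSpace ℝ (Fin 3) => γ • (z - 0) + V z) = selfSimilarTransport γ 0 V := by
      funext z; rw [selfSimilarTransport_apply]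
    rw [e] at h
    exact h
  have hWZ : HasDerivAt (fun t => selfSimilarTransport γ 0 V (Z t))
      ((γ • ContinuousLinearMap.id ℝ (EuclideanSpace ℝ (Fin 3)) + fderiv ℝ V (Z σ)) (-(selfSimilarTransport γ 0 V (Z σ)))) σ :=
    hW.comp_hasDerivAt σ hZ
  have hinner := hZ.inner ℝ hWZ
  -- simplify the derivative
  have happ : (γ • ContinuousLinearMap.id ℝ (EuclideanSpace ℝ (Fin 3)) + fderiv ℝ V (Z σ)) (-(selfSimilarTransport γ 0 V (Z σ))) =
      γ • (-(selfSimilarTransport γ 0 V (Z σ))) + fderiv ℝ V (Z σ) (-(selfSimilarTransport γ 0 V (Z σ))) := rfl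
  have e : ⟪Z σ, (γ • ContinuousLinearMap.id ℝ (EuclideanSpace ℝ (Fin 3)) + fderiv ℝ V (Z σ))
        (-(selfSimilarTransport γ 0 V (Z σ)))⟫ + ⟪-(selfSimilarTransport γ 0 V (Z σ)), selfSimilarTransport γ 0 V (Z σ)⟫ =
      -(‖selfSimilarTransport γ 0 V (Z σ)‖ ^ 2 + γ * ⟪Z σ, selfSimilarTransport γ 0 V (Z σ)⟫ +
        ⟪Z σ, fderiv ℝ V (Z σ) (selfSimilarTransport γ 0 V (Z σ))⟫) := by
    rw [happ, map_neg, smul_neg, inner_add_right, inner_neg_right, inner_neg_right, inner_neg_left, real_inner_smul_right,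
      real_inner_self_eq_norm_sq]
    ring
  exact hinner.congr_deriv e

/-- **Negative derivative ⇒ strictly smaller just to the right.** [folklore] -/
theorem eventually_lt_right_of_hasDerivAt_neg {f : ℝ → ℝ} {f' x : ℝ} (hf : HasDerivAt f f' x) (hneg : f' < 0) :
    ∀ᶠ z in 𝓝[>] x, f z < f x := by
  have h := hf.hasDerivWithinAt (s := Ioi x) |>.limsup_slope_le' (lt_irrefl x) hneg
  filter_upwards [h, self_mem_nhdsWithin] with z hz hzx
  rw [slope_def_field] at hz
  have hpos : 0 < z - x := sub_pos.2 hzx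
  have : f z - f x < 0 := by
    by_contra hge
    have : 0 ≤ (f z - f x) / (z - x) := div_nonneg (le_of_not_gt hge) hpos.le
    linarith
  linarith

variable {P' : EuclideanSpace ℝ (Fin 3) → ℝ}

/-- **THE BAND BOOTSTRAP** (see the module docstring).  `V ∈ C¹`; backward arc `Z′ = −W(Z)` on `[t₀, t₁]`, high and vortical throughout, `‖Z t₀‖ ≥ 2R₁ > 0`,
`ℛ(Z t₀) + m₀‖Z t₀‖² ≤ 0`; inflow half-band deficit beyond `R₁` with constants `c₁ > 0`, `μ`; slope `0 ≤ κ < μ`, `0 ≤ m₀`, `m₀ + κ(t₁ − t₀) ≤ c₁`.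
Then `‖Z t₀‖ ≤ ‖Z s‖` and `ℛ(Z s) + (m₀ + κ(s − t₀))‖Z s‖² ≤ 0` on `[t₀, t₁]`. [folklore] -/
theorem band_bootstrap (hV : ContDiff ℝ 1 V) {c₁ μ R₁ h t₀ t₁ m₀ κ : ℝ} (hc₁ : 0 < c₁) (hR₁ : 0 < R₁)
    (ht : t₀ ≤ t₁) (hm₀ : 0 ≤ m₀) (hκ0 : 0 ≤ κ) (hκμ : κ < μ) (hmc : m₀ + κ * (t₁ - t₀) ≤ c₁)
    (hdef : ∀ y : EuclideanSpace ℝ (Fin 3), R₁ ≤ ‖y‖ → h < selfSimilarBernoulli γ 0 V P' y → curl V y ≠ 0 →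
      -(c₁ * ‖y‖ ^ 2) ≤ ⟪y, selfSimilarTransport γ 0 V y⟫ → ⟪y, selfSimilarTransport γ 0 V y⟫ ≤ 0 →
      (2 * c₁ ^ 2 + μ) * ‖y‖ ^ 2 ≤ ‖selfSimilarTransport γ 0 V y‖ ^ 2 + γ * ⟪y, selfSimilarTransport γ 0 V y⟫ +
        ⟪y, fderiv ℝ V y (selfSimilarTransport γ 0 V y)⟫)
    {Z : ℝ → EuclideanSpace ℝ (Fin 3)}
    (hZ : ∀ s ∈ Icc t₀ t₁, HasDerivAt Z (-(selfSimilarTransport γ 0 V (Z s))) s)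
    (hhigh : ∀ s ∈ Icc t₀ t₁, h < selfSimilarBernoulli γ 0 V P' (Z s))
    (hvort : ∀ s ∈ Icc t₀ t₁, curl V (Z s) ≠ 0)
    (hZ0 : 2 * R₁ ≤ ‖Z t₀‖)
    (hrate0 : ⟪Z t₀, selfSimilarTransport γ 0 V (Z t₀)⟫ + m₀ * ‖Z t₀‖ ^ 2 ≤ 0) :
    ∀ s ∈ Icc t₀ t₁, ‖Z t₀‖ ≤ ‖Z s‖ ∧
      ⟪Z s, selfSimilarTransport γ 0 V (Z s)⟫ + (m₀ + κ * (s - t₀)) * ‖Z s‖ ^ 2 ≤ 0 := by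
  -- notation
  set W := selfSimilarTransport γ 0 V with hWdef
  set ℛ : ℝ → ℝ := fun s => ⟪Z s, W (Z s)⟫ with hℛdef
  set N : ℝ → ℝ := fun s => ‖Z s‖ ^ 2 with hNdef
  set m : ℝ → ℝ := fun s => m₀ + κ * (s - t₀) with hmdef
  set ψ : ℝ → ℝ := fun s => ℛ s + m s * N s with hψdef
  -- derivatives along the arc
  have hℛd : ∀ s ∈ Icc t₀ t₁, HasDerivAt ℛ
      (-(‖W (Z s)‖ ^ 2 + γ * ⟪Z s, W (Z s)⟫ + ⟪Z s, fderiv ℝ V (Z s) (W (Z s))⟫)) s :=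
    fun s hs => hasDerivAt_radialRate_comp (γ := γ) hV (hZ s hs)
  have hNd : ∀ s ∈ Icc t₀ t₁, HasDerivAt N (2 * ⟪Z s, -(W (Z s))⟫) s := fun s hs => (hZ s hs).norm_sq
  have hmd : ∀ s, HasDerivAt m κ s := by
    intro s
    have := ((hasDerivAt_id s).sub_const t₀).const_mul κ |>.const_add m₀
    simpa [hmdef] using this
  have hψd : ∀ s ∈ Icc t₀ t₁, HasDerivAt ψ
      (-(‖W (Z s)‖ ^ 2 + γ * ⟪Z s, W (Z s)⟫ + ⟪Z s, fderiv ℝ V (Z s) (W (Z s))⟫) +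
        (κ * N s + m s * (2 * ⟪Z s, -(W (Z s))⟫))) s :=
    fun s hs => (hℛd s hs).add ((hmd s).mul (hNd s hs))
  -- continuity on the arc
  have hZc : ContinuousOn Z (Icc t₀ t₁) := fun s hs => (hZ s hs).continuousAt.continuousWithinAt
  have hNc : ContinuousOn N (Icc t₀ t₁) := fun s hs => (hNd s hs).continuousAt.continuousWithinAt
  have hψc : ContinuousOn ψ (Icc t₀ t₁) := fun s hs => (hψd s hs).continuousAt.continuousWithinAt
  have hnc : ContinuousOn (fun s => ‖Z s‖) (Icc t₀ t₁) := hZc.norm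
  -- the good set and its supremum
  set good : ℝ → Prop := fun s => ‖Z t₀‖ ≤ ‖Z s‖ ∧ ψ s ≤ 0 with hgooddef
  have hgood0 : good t₀ := ⟨le_rfl, by simp only [hψdef, hmdef, hℛdef, hNdef, sub_self, mul_zero, add_zero]; exact hrate0⟩
  set G : Set ℝ := {s | s ∈ Icc t₀ t₁ ∧ ∀ s' ∈ Icc t₀ s, good s'} with hGdef
  have hG0 : t₀ ∈ G := ⟨left_mem_Icc.2 ht, fun s' hs' => by
    have : s' = t₀ := le_antisymm hs'.2 hs'.1
    rw [this]; exact hgood0⟩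
  have hGne : G.Nonempty := ⟨t₀, hG0⟩
  have hGbdd : BddAbove G := ⟨t₁, fun s hs => hs.1.2⟩
  set sstar := sSup G with hsdef
  have hs0 : t₀ ≤ sstar := le_csSup hGbdd hG0
  have hs1 : sstar ≤ t₁ := csSup_le hGne fun s hs => hs.1.2
  -- good below the supremum
  have hgood_lt : ∀ s, t₀ ≤ s → s < sstar → good s := by
    intro s hs0' hs
    obtain ⟨σ, hσG, hsσ⟩ := exists_lt_of_lt_csSup hGne hs
    exact hσG.2 s ⟨hs0', hsσ.le⟩
  -- the good conditions are closed on `[t₀, t₁]`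
  have hclosed : IsClosed {s | s ∈ Icc t₀ t₁ ∧ good s} := by
    have h1 : IsClosed {s | s ∈ Icc t₀ t₁ ∧ ‖Z t₀‖ ≤ ‖Z s‖} := by
      have := hnc.preimage_isClosed_of_isClosed isClosed_Icc (isClosed_Ici (a := ‖Z t₀‖))
      convert this using 1
      ext s; simp [Set.mem_preimage]
    have h2 : IsClosed {s | s ∈ Icc t₀ t₁ ∧ ψ s ≤ 0} := by
      have := hψc.preimage_isClosed_of_isClosed isClosed_Icc (isClosed_Iic (a := (0 : ℝ)))
      convert this using 1
      ext s; simp [Set.mem_preimage]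
    have e : {s | s ∈ Icc t₀ t₁ ∧ good s} = {s | s ∈ Icc t₀ t₁ ∧ ‖Z t₀‖ ≤ ‖Z s‖} ∩ {s | s ∈ Icc t₀ t₁ ∧ ψ s ≤ 0} := by
      ext s; simp only [hgooddef, mem_setOf_eq, mem_inter_iff]; tauto
    rw [e]; exact h1.inter h2
  have hgood_star : good sstar := by
    rcases hs0.lt_or_eq with hpos | hzero
    · have hsub : Ico t₀ sstar ⊆ {s | s ∈ Icc t₀ t₁ ∧ good s} := fun s hs =>
        ⟨⟨hs.1, le_trans hs.2.le hs1⟩, hgood_lt s hs.1 hs.2⟩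
      have hcl := hclosed.closure_subset_iff.2 hsub
      have hmem : sstar ∈ closure (Ico t₀ sstar) := by
        rw [closure_Ico hpos.ne]; exact right_mem_Icc.2 hs0
      exact (hcl hmem).2
    · rw [← hzero]; exact hgood0
  have hgood_le : ∀ s ∈ Icc t₀ sstar, good s := by
    intro s hs
    rcases hs.2.lt_or_eq with hl | he
    · exact hgood_lt s hs.1 hl
    · rw [he]; exact hgood_star
  -- ### the supremum is `t₁`
  have hstar : sstar = t₁ := by
    by_contra hne
    have hlt : sstar < t₁ := lt_of_le_of_ne hs1 hne
    have hmem : sstar ∈ Icc t₀ t₁ := ⟨hs0, hs1⟩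
    -- facts at `sstar`
    have hfar : 2 * R₁ ≤ ‖Z sstar‖ := le_trans hZ0 hgood_star.1
    have hm_le : m sstar ≤ c₁ := by
      have : κ * (sstar - t₀) ≤ κ * (t₁ - t₀) := mul_le_mul_of_nonneg_left (by linarith) hκ0
      simp only [hmdef]; linarith
    have hm_ge : 0 ≤ m sstar := by
      simp only [hmdef]; nlinarith
    -- (1) `ψ < 0` just to the right of `sstar`
    have hψneg : ∀ᶠ s in 𝓝[>] sstar, ψ s < 0 := by
      rcases (hgood_star.2).lt_or_eq with hlt0 | heq0
      · -- by continuity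
        have hc : ContinuousWithinAt ψ (Icc t₀ t₁) sstar := hψc sstar hmem
        have h1 : ∀ᶠ s in 𝓝[Icc t₀ t₁] sstar, ψ s < 0 := hc.eventually (gt_mem_nhds hlt0)
        have h2 : 𝓝[>] sstar ≤ 𝓝[Icc t₀ t₁] sstar ⊔ 𝓝[(Icc t₀ t₁)ᶜ] sstar := by
          rw [← nhdsWithin_union, union_compl_self, nhdsWithin_univ]; exact nhdsWithin_le_nhds
        -- points just right of `sstar` and `< t₁` lie in `Icc t₀ t₁`
        have h3 : ∀ᶠ s in 𝓝[>] sstar, s ∈ Icc t₀ t₁ := by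
          filter_upwards [Ioo_mem_nhdsGT hlt] with s hs
          exact ⟨le_trans hs0 hs.1.le, hs.2.le⟩
        have h4 : ∀ᶠ s in 𝓝 sstar, s ∈ Icc t₀ t₁ → ψ s < 0 := eventually_nhdsWithin_iff.1 h1
        filter_upwards [h3, nhdsWithin_le_nhds h4] with s hs hs'
        exact hs' hs
      · -- tight: the point is in the inflow half-band, the deficit makes `ψ′ < 0`
        have hN : N sstar = ‖Z sstar‖ ^ 2 := rfl
        have hℛeq : ℛ sstar = -(m sstar * N sstar) := by
          have : ψ sstar = ℛ sstar + m sstar * N sstar := rfl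
          linarith
        have hR₁le : R₁ ≤ ‖Z sstar‖ := by linarith
        have hband_lo : -(c₁ * ‖Z sstar‖ ^ 2) ≤ ⟪Z sstar, W (Z sstar)⟫ := by
          show -(c₁ * ‖Z sstar‖ ^ 2) ≤ ℛ sstar
          rw [hℛeq, hN]
          have : m sstar * ‖Z sstar‖ ^ 2 ≤ c₁ * ‖Z sstar‖ ^ 2 := mul_le_mul_of_nonneg_right hm_le (sq_nonneg _)
          linarith
        have hband_hi : ⟪Z sstar, W (Z sstar)⟫ ≤ 0 := by
          show ℛ sstar ≤ 0
          rw [hℛeq, hN]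
          have : 0 ≤ m sstar * ‖Z sstar‖ ^ 2 := mul_nonneg hm_ge (sq_nonneg _)
          linarith
        have hdef' := hdef (Z sstar) hR₁le (hhigh sstar hmem) (hvort sstar hmem) hband_lo hband_hi
        -- the derivative of `ψ` at `sstar` is `≤ (κ − μ) N < 0`
        have hψ' := hψd sstar hmem
        have hNpos : 0 < N sstar := by
          rw [hN]; have : 0 < ‖Z sstar‖ := by linarith
          positivity
        have hderiv_neg : -(‖W (Z sstar)‖ ^ 2 + γ * ⟪Z sstar, W (Z sstar)⟫ + ⟪Z sstar, fderiv ℝ V (Z sstar) (W (Z sstar))⟫) +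
            (κ * N sstar + m sstar * (2 * ⟪Z sstar, -(W (Z sstar))⟫)) < 0 := by
          rw [inner_neg_right]
          have e1 : ⟪Z sstar, W (Z sstar)⟫ = -(m sstar * N sstar) := hℛeq
          rw [e1]
          have hsq : m sstar ^ 2 ≤ c₁ ^ 2 := by nlinarith
          have hdef'' : (2 * c₁ ^ 2 + μ) * N sstar ≤
              ‖W (Z sstar)‖ ^ 2 + γ * -(m sstar * N sstar) + ⟪Z sstar, fderiv ℝ V (Z sstar) (W (Z sstar))⟫ := by
            rw [hN]; rw [hN] at e1; rw [← e1]; exact hdef'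
          nlinarith [hNpos, hsq, mul_nonneg (sq_nonneg (m sstar)) hNpos.le]
        have hev := eventually_lt_right_of_hasDerivAt_neg hψ' hderiv_neg
        rw [heq0] at hev
        exact hev
    -- (2) choose `ε > 0` with `(sstar, sstar + ε) ⊆ {ψ < 0} ∩ (sstar, t₁)`
    have hev2 : ∀ᶠ s in 𝓝[>] sstar, ψ s < 0 ∧ s < t₁ :=
      hψneg.and (Filter.eventually_of_mem (Ioo_mem_nhdsGT hlt) fun s hs => hs.2)
    obtain ⟨b, hb, hbsub⟩ := (mem_nhdsGT_iff_exists_Ioo_subset).1 hev2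
    set ε : ℝ := (min b t₁ - sstar) / 2 with hεdef
    have hεpos : 0 < ε := by
      have : sstar < min b t₁ := lt_min hb hlt
      rw [hεdef]; linarith
    have hεb : sstar + ε < b := by
      have : min b t₁ ≤ b := min_le_left _ _
      rw [hεdef]; linarith
    have hεt : sstar + ε < t₁ := by
      have : min b t₁ ≤ t₁ := min_le_right _ _
      rw [hεdef]; linarith
    have hψle : ∀ s ∈ Icc sstar (sstar + ε), ψ s ≤ 0 := by
      intro s hs
      rcases hs.1.lt_or_eq with hl | he
      · exact (hbsub ⟨hl, lt_of_le_of_lt hs.2 hεb⟩).1.le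
      · rw [← he]; exact hgood_star.2
    -- (3) on `[sstar, sstar + ε]` the radius is non-decreasing (`N′ = −2ℛ ≥ 2mN ≥ 0`)
    have hsubI : Icc sstar (sstar + ε) ⊆ Icc t₀ t₁ := fun s hs => ⟨le_trans hs0 hs.1, le_trans hs.2 hεt.le⟩
    have hNmono : MonotoneOn N (Icc sstar (sstar + ε)) := by
      have hcont : ContinuousOn N (Icc sstar (sstar + ε)) := hNc.mono hsubI
      have hdiff : DifferentiableOn ℝ N (interior (Icc sstar (sstar + ε))) := by
        rw [interior_Icc]
        exact fun s hs => (hNd s (hsubI (Ioo_subset_Icc_self hs))).differentiableAt.differentiableWithinAt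
      refine monotoneOn_of_deriv_nonneg (convex_Icc _ _) hcont hdiff fun s hs => ?_
      rw [interior_Icc] at hs
      have hsI : s ∈ Icc sstar (sstar + ε) := Ioo_subset_Icc_self hs
      rw [(hNd s (hsubI hsI)).deriv, inner_neg_right]
      have hψs : ψ s ≤ 0 := hψle s hsI
      have hms : 0 ≤ m s := by simp only [hmdef]; nlinarith [hs.1, hs0]
      have : ℛ s ≤ -(m s * N s) := by
        have : ψ s = ℛ s + m s * N s := rfl
        linarith
      have hmn : 0 ≤ m s * N s := mul_nonneg hms (sq_nonneg _)
      show 0 ≤ 2 * -⟪Z s, W (Z s)⟫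
      have : ⟪Z s, W (Z s)⟫ = ℛ s := rfl
      linarith
    have hrad : ∀ s ∈ Icc sstar (sstar + ε), ‖Z t₀‖ ≤ ‖Z s‖ := by
      intro s hs
      have hNle : N sstar ≤ N s := hNmono (left_mem_Icc.2 (by linarith)) hs hs.1
      have h1 : ‖Z sstar‖ ^ 2 ≤ ‖Z s‖ ^ 2 := hNle
      have h2 : ‖Z sstar‖ ≤ ‖Z s‖ := (pow_le_pow_iff_left₀ (norm_nonneg _) (norm_nonneg _) two_ne_zero).1 h1
      exact le_trans hgood_star.1 h2
    -- (4) so `sstar + ε ∈ G`: contradiction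
    have hmemG : sstar + ε ∈ G := by
      refine ⟨⟨by linarith, hεt.le⟩, fun s' hs' => ?_⟩
      rcases le_or_gt s' sstar with hle | hgt
      · exact hgood_le s' ⟨hs'.1, hle⟩
      · exact ⟨hrad s' ⟨hgt.le, hs'.2⟩, hψle s' ⟨hgt.le, hs'.2⟩⟩
    have := le_csSup hGbdd hmemG
    linarith
  -- ### conclusion
  intro s hs
  have hsg : good s := hgood_le s ⟨hs.1, by rw [hstar]; exact hs.2⟩
  exact ⟨hsg.1, hsg.2⟩

end BandClock

end Summit.NavierStokesRegularity.NavierStokesRegularity.Theorems.PowerGaugeEulerLiouville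

end
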